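import Mathlib
import Summits.Ventures.PercRepro2.Defs
import Summits.Ventures.PercRepro2.Independence
import Summits.Ventures.PercRepro2.Harris
import Summits.Ventures.PercRepro2.Graph
import Summits.Ventures.PercRepro2.Exploration
import Summits.Ventures.PercRepro2.FourFunctions
import Summits.Ventures.PercRepro2.Induced
import Summits.Ventures.PercRepro2.Frontier

/-!
# The two-mark avoidance inequality, part 1: the events, the base case and the exploration step
(blind cell PercRepro2, p1 g36; proofs/P1-HB1.md)

Fix a source `s`, two marks `a, o` and two vertex sets `X, Y`; on an induced subgraph `G[U]` put

* `L1 X = {s ↔ a, s ↮ o, s ↮ X, o ↮ X}`,  `L2 Y = {s ↔ o, s ↮ a, s ↮ Y, a ↮ Y}`,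
* `R1 Z = {s ↔ a, s ↔ o, s ↮ Z}`,  `R2 W = {s, a, o, W pairwise disconnected}`.

This file: the four events and their dependence on the edges inside `U`; the case `X ∩ Y = ∅` of
`P(L1 X) · P(L2 Y) ≤ P(R1 (X ∩ Y)) · P(R2 (X ∪ Y))` by the four functions theorem (the join has
`s ↔ a, o`; every disconnection of `R2 (X ∪ Y)` holds in `ω` or in `ω'`, hence in the meet); and the
exploration step around a set `Z ⊆ X ∩ Y`: the pointwise domain Markov identity (one application
per source `s`, `a`, `o`) and the tower identity of Frontier.lean express each event on `G[U]` as
the same event on `G[U ∖ Z]` with the frontier of `Z` added to the avoided sets. The induction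
is in CaseOneHB1Avoid.lean. Standard axioms. -/

namespace Summit.Ventures.PercRepro2

namespace TwoMark

section Defs

variable {V : Type*} {E : Type*} [DecidableEq V]

/-- `L1 X = {s ↔ a, s ↮ o, s ↮ X, o ↮ X}` on `G[U]`. -/
def L1 (ends : E → Sym2 V) (U : Finset V) (s a o : V) (X : Finset V) : Set (Config E) :=
  QEvent ends U s {a} ∩ REvent ends U s ({o} ∪ X) ∩ REvent ends U o X

/-- `L2 Y = {s ↔ o, s ↮ a, s ↮ Y, a ↮ Y}` on `G[U]`. -/
def L2 (ends : E → Sym2 V) (U : Finset V) (s a o : V) (Y : Finset V) : Set (Config E) :=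
  QEvent ends U s {o} ∩ REvent ends U s ({a} ∪ Y) ∩ REvent ends U a Y

/-- `R1 Z = {s ↔ a, s ↔ o, s ↮ Z}` on `G[U]`. -/
def R1 (ends : E → Sym2 V) (U : Finset V) (s a o : V) (Z : Finset V) : Set (Config E) :=
  QEvent ends U s {a, o} ∩ REvent ends U s Z

/-- `R2 W = {s ↮ a, s ↮ o, a ↮ o, s ↮ W, a ↮ W, o ↮ W}` on `G[U]`. -/
def R2 (ends : E → Sym2 V) (U : Finset V) (s a o : V) (W : Finset V) : Set (Config E) :=
  REvent ends U s ({a, o} ∪ W) ∩ REvent ends U a ({o} ∪ W) ∩ REvent ends U o W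

variable {ends : E → Sym2 V} {U : Finset V} {s a o : V}

/-- `R1` is antitone in the avoided set. -/
lemma R1_anti {Z Z' : Finset V} (h : Z ⊆ Z') : R1 ends U s a o Z' ⊆ R1 ends U s a o Z :=
  Set.inter_subset_inter_right _ (REvent_anti ends U s h)

/-- `L1` is determined by the edges inside `U`. -/
lemma dependsOn_L1 (X : Finset V) : DependsOn (· ∈ L1 ends U s a o X) (within ends (↑U)) :=
  dependsOn_inter_same (dependsOn_inter_same (dependsOn_QEvent ends U s {a})
    (dependsOn_REvent ends U s ({o} ∪ X))) (dependsOn_REvent ends U o X)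

/-- `L2` is determined by the edges inside `U`. -/
lemma dependsOn_L2 (Y : Finset V) : DependsOn (· ∈ L2 ends U s a o Y) (within ends (↑U)) :=
  dependsOn_inter_same (dependsOn_inter_same (dependsOn_QEvent ends U s {o})
    (dependsOn_REvent ends U s ({a} ∪ Y))) (dependsOn_REvent ends U a Y)

/-- `R1` is determined by the edges inside `U`. -/
lemma dependsOn_R1 (Z : Finset V) : DependsOn (· ∈ R1 ends U s a o Z) (within ends (↑U)) :=
  dependsOn_inter_same (dependsOn_QEvent ends U s {a, o}) (dependsOn_REvent ends U s Z)

/-- `R2` is determined by the edges inside `U`. -/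
lemma dependsOn_R2 (W : Finset V) : DependsOn (· ∈ R2 ends U s a o W) (within ends (↑U)) :=
  dependsOn_inter_same (dependsOn_inter_same (dependsOn_REvent ends U s ({a, o} ∪ W))
    (dependsOn_REvent ends U a ({o} ∪ W))) (dependsOn_REvent ends U o W)

end Defs

/-! ## The case `X ∩ Y = ∅`: the four functions theorem applies directly -/

section Base

variable {V : Type*} {E : Type*} [Fintype E] [DecidableEq E] [DecidableEq V]
  {R : Type*} [CommRing R] [LinearOrder R] [IsStrictOrderedRing R]

omit [Fintype E] [DecidableEq E] in
/-- The join of `ω ∈ L1 X` and `ω' ∈ L2 Y` lies in `R1 ∅`; the meet lies in `R2 (X ∪ Y)`. -/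
lemma sup_mem_R1_and_inf_mem_R2 {ends : E → Sym2 V} {U : Finset V} {s a o : V}
    {X Y : Finset V} {ω ω' : Config E} (hω : ω ∈ L1 ends U s a o X)
    (hω' : ω' ∈ L2 ends U s a o Y) :
    ω ⊔ ω' ∈ R1 ends U s a o ∅ ∧ ω ⊓ ω' ∈ R2 ends U s a o (X ∪ Y) := by
  obtain ⟨⟨hQ, hR⟩, hO⟩ := hω
  obtain ⟨⟨hQ', hR'⟩, hA'⟩ := hω'
  simp only [mem_QEvent, mem_REvent, Finset.forall_mem_union, Finset.mem_singleton,
    forall_eq] at hQ hR hO hQ' hR' hA'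
  have hsa : Conn ends (induced ends (↑U) ω) s a := hQ
  have hso' : Conn ends (induced ends (↑U) ω') s o := hQ'
  -- monotonicity of connections under the lattice operations
  have hsup₁ : ∀ {u v : V}, Conn ends (induced ends (↑U) ω) u v →
      Conn ends (induced ends (↑U) (ω ⊔ ω')) u v :=
    fun h => conn_mono (induced_mono le_sup_left) h
  have hsup₂ : ∀ {u v : V}, Conn ends (induced ends (↑U) ω') u v →
      Conn ends (induced ends (↑U) (ω ⊔ ω')) u v :=
    fun h => conn_mono (induced_mono le_sup_right) h
  have hinf₁ : ∀ {u v : V}, Conn ends (induced ends (↑U) (ω ⊓ ω')) u v →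
      Conn ends (induced ends (↑U) ω) u v :=
    fun h => conn_mono (induced_mono inf_le_left) h
  have hinf₂ : ∀ {u v : V}, Conn ends (induced ends (↑U) (ω ⊓ ω')) u v →
      Conn ends (induced ends (↑U) ω') u v :=
    fun h => conn_mono (induced_mono inf_le_right) h
  refine ⟨⟨?_, ?_⟩, ⟨?_, ?_⟩, ?_⟩
  · -- join: `s ↔ a` and `s ↔ o`
    intro x hx
    simp only [Finset.mem_insert, Finset.mem_singleton] at hx
    rcases hx with rfl | rfl
    · exact hsup₁ hsa
    · exact hsup₂ hso'
  · intro x hx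
    exact absurd hx (Finset.notMem_empty x)
  · -- meet: `s ↮ a`, `s ↮ o`, `s ↮ X ∪ Y`
    intro x hx
    simp only [Finset.mem_union, Finset.mem_insert, Finset.mem_singleton] at hx
    rcases hx with (rfl | rfl) | hx | hx
    · exact fun h => hR'.1 (hinf₂ h)
    · exact fun h => hR.1 (hinf₁ h)
    · exact fun h => hR.2 x hx (hinf₁ h)
    · exact fun h => hR'.2 x hx (hinf₂ h)
  · -- meet: `a ↮ o`, `a ↮ X ∪ Y`
    intro x hx
    simp only [Finset.mem_union, Finset.mem_singleton] at hx
    rcases hx with rfl | hx | hx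
    · exact fun h => hR.1 (conn_trans hsa (hinf₁ h))
    · exact fun h => hR.2 x hx (conn_trans hsa (hinf₁ h))
    · exact fun h => hA' x hx (hinf₂ h)
  · -- meet: `o ↮ X ∪ Y`
    intro x hx
    simp only [Finset.mem_union] at hx
    rcases hx with hx | hx
    · exact fun h => hO x hx (hinf₁ h)
    · exact fun h => hR'.2 x hx (conn_trans hso' (hinf₂ h))

/-- The case `X ∩ Y = ∅` of the two-mark avoidance inequality. -/
lemma twoMark_of_inter_eq_empty (p : E → R) (hp : IsProbVec p) (ends : E → Sym2 V) (s a o : V)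
    (U X Y : Finset V) (hZ : X ∩ Y = ∅) :
    prob p (L1 ends U s a o X) * prob p (L2 ends U s a o Y) ≤
      prob p (R1 ends U s a o (X ∩ Y)) * prob p (R2 ends U s a o (X ∪ Y)) := by
  rw [hZ]
  exact prob_mul_prob_le_of_sup_inf hp fun ω hω ω' hω' => sup_mem_R1_and_inf_mem_R2 hω hω'

end Base

/-! ## The exploration step: the four events on `G[U ∖ Z]` with the frontier added -/

section Explore

variable {V : Type*} {E : Type*} [Fintype E] [DecidableEq V] {ends : E → Sym2 V}

/-- One source: the pointwise domain Markov identity as a membership statement. -/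
lemma mem_QR_iff {U Z : Finset V} (hZU : Z ⊆ U) {v : V} (hvZ : v ∉ Z) (C W : Finset V)
    (ω : Config E) :
    ω ∈ QEvent ends U v C ∩ REvent ends U v (W ∪ Z) ↔
      ω ∈ QEvent ends (U \ Z) v C ∩ REvent ends (U \ Z) v (W ∪ frontier ends U Z ω) := by
  have h := Set.ext_iff.1 (QEvent_inter_REvent_union_eq (ends := ends) hZU hvZ C W) ω
  simpa only [Set.mem_setOf_eq] using h

/-- One source, no target: the avoidance of `W ∪ Z` is the avoidance of `W ∪ frontier`. -/
lemma mem_R_iff {U Z : Finset V} (hZU : Z ⊆ U) {v : V} (hvZ : v ∉ Z) (W : Finset V)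
    (ω : Config E) :
    ω ∈ REvent ends U v (W ∪ Z) ↔ ω ∈ REvent ends (U \ Z) v (W ∪ frontier ends U Z ω) := by
  have h := mem_QR_iff (ends := ends) hZU hvZ ∅ W ω
  simpa only [QEvent_empty, Set.univ_inter] using h

/-- `L1 X` on `G[U]` is `L1 (X ∖ Z ∪ frontier)` on `G[U ∖ Z]`. -/
lemma L1_eq {U Z : Finset V} (hZU : Z ⊆ U) {s a o : V} (hsZ : s ∉ Z) (hoZ : o ∉ Z)
    {X : Finset V} (hZX : Z ⊆ X) :
    L1 ends U s a o X = {ω | ω ∈ L1 ends (U \ Z) s a o ((X \ Z) ∪ frontier ends U Z ω)} := by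
  have hX : ({o} ∪ (X \ Z)) ∪ Z = {o} ∪ X := by
    rw [Finset.union_assoc, Finset.sdiff_union_of_subset hZX]
  have hX' : (X \ Z) ∪ Z = X := Finset.sdiff_union_of_subset hZX
  ext ω
  simp only [L1, Set.mem_setOf_eq]
  have e1 := mem_QR_iff (ends := ends) hZU hsZ {a} ({o} ∪ (X \ Z)) ω
  have e2 := mem_R_iff (ends := ends) hZU hoZ (X \ Z) ω
  rw [hX] at e1
  rw [hX'] at e2
  rw [Finset.union_assoc] at e1
  constructor
  · rintro ⟨h₁, h₂⟩
    exact ⟨e1.1 h₁, e2.1 h₂⟩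
  · rintro ⟨h₁, h₂⟩
    exact ⟨e1.2 h₁, e2.2 h₂⟩

/-- `L2 Y` on `G[U]` is `L2 (Y ∖ Z ∪ frontier)` on `G[U ∖ Z]`. -/
lemma L2_eq {U Z : Finset V} (hZU : Z ⊆ U) {s a o : V} (hsZ : s ∉ Z) (haZ : a ∉ Z)
    {Y : Finset V} (hZY : Z ⊆ Y) :
    L2 ends U s a o Y = {ω | ω ∈ L2 ends (U \ Z) s a o ((Y \ Z) ∪ frontier ends U Z ω)} := by
  have hY : ({a} ∪ (Y \ Z)) ∪ Z = {a} ∪ Y := by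
    rw [Finset.union_assoc, Finset.sdiff_union_of_subset hZY]
  have hY' : (Y \ Z) ∪ Z = Y := Finset.sdiff_union_of_subset hZY
  ext ω
  simp only [L2, Set.mem_setOf_eq]
  have e1 := mem_QR_iff (ends := ends) hZU hsZ {o} ({a} ∪ (Y \ Z)) ω
  have e2 := mem_R_iff (ends := ends) hZU haZ (Y \ Z) ω
  rw [hY] at e1
  rw [hY'] at e2
  rw [Finset.union_assoc] at e1
  constructor
  · rintro ⟨h₁, h₂⟩
    exact ⟨e1.1 h₁, e2.1 h₂⟩
  · rintro ⟨h₁, h₂⟩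
    exact ⟨e1.2 h₁, e2.2 h₂⟩

/-- `R1 Z` on `G[U]` is `R1 (frontier)` on `G[U ∖ Z]`. -/
lemma R1_eq {U Z : Finset V} (hZU : Z ⊆ U) {s a o : V} (hsZ : s ∉ Z) :
    R1 ends U s a o Z = {ω | ω ∈ R1 ends (U \ Z) s a o (frontier ends U Z ω)} := by
  ext ω
  simp only [R1, Set.mem_setOf_eq]
  have e1 := mem_QR_iff (ends := ends) hZU hsZ {a, o} ∅ ω
  rw [Finset.empty_union, Finset.empty_union] at e1
  exact e1

/-- `R2 W` on `G[U]` is `R2 (W ∖ Z ∪ frontier)` on `G[U ∖ Z]`. -/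
lemma R2_eq {U Z : Finset V} (hZU : Z ⊆ U) {s a o : V} (hsZ : s ∉ Z) (haZ : a ∉ Z) (hoZ : o ∉ Z)
    {W : Finset V} (hZW : Z ⊆ W) :
    R2 ends U s a o W = {ω | ω ∈ R2 ends (U \ Z) s a o ((W \ Z) ∪ frontier ends U Z ω)} := by
  have hW₁ : ({a, o} ∪ (W \ Z)) ∪ Z = {a, o} ∪ W := by
    rw [Finset.union_assoc, Finset.sdiff_union_of_subset hZW]
  have hW₂ : ({o} ∪ (W \ Z)) ∪ Z = {o} ∪ W := by
    rw [Finset.union_assoc, Finset.sdiff_union_of_subset hZW]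
  have hW₃ : (W \ Z) ∪ Z = W := Finset.sdiff_union_of_subset hZW
  ext ω
  simp only [R2, Set.mem_setOf_eq]
  have e1 := mem_R_iff (ends := ends) hZU hsZ ({a, o} ∪ (W \ Z)) ω
  have e2 := mem_R_iff (ends := ends) hZU haZ ({o} ∪ (W \ Z)) ω
  have e3 := mem_R_iff (ends := ends) hZU hoZ (W \ Z) ω
  rw [hW₁] at e1
  rw [hW₂] at e2
  rw [hW₃] at e3
  rw [Finset.union_assoc] at e1 e2
  constructor
  · rintro ⟨⟨h₁, h₂⟩, h₃⟩
    exact ⟨⟨e1.1 h₁, e2.1 h₂⟩, e3.1 h₃⟩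
  · rintro ⟨⟨h₁, h₂⟩, h₃⟩
    exact ⟨⟨e1.2 h₁, e2.2 h₂⟩, e3.2 h₃⟩

end Explore

/-! ## The tower identities -/

section Tower

variable {V : Type*} {E : Type*} [Fintype E] [DecidableEq E] [Fintype V] [DecidableEq V]
  {R : Type*} [CommRing R]

/-- `P(L1 X) = ∑_ω weight ω · P(L1 (X ∖ Z ∪ frontier ω))` on `G[U ∖ Z]`. -/
lemma prob_L1_eq (p : E → R) (ends : E → Sym2 V) {U Z : Finset V} (hZU : Z ⊆ U) {s a o : V}
    (hsZ : s ∉ Z) (hoZ : o ∉ Z) {X : Finset V} (hZX : Z ⊆ X) :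
    prob p (L1 ends U s a o X) = ∑ ω, weight p ω *
      prob p (L1 ends (U \ Z) s a o ((X \ Z) ∪ frontier ends U Z ω)) := by
  rw [L1_eq hZU hsZ hoZ hZX]
  exact prob_tower p (disjoint_touches_within_sdiff ends U Z) (dependsOn_frontier ends U Z)
    fun T => dependsOn_L1 ((X \ Z) ∪ T)

/-- `P(L2 Y) = ∑_ω weight ω · P(L2 (Y ∖ Z ∪ frontier ω))` on `G[U ∖ Z]`. -/
lemma prob_L2_eq (p : E → R) (ends : E → Sym2 V) {U Z : Finset V} (hZU : Z ⊆ U) {s a o : V}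
    (hsZ : s ∉ Z) (haZ : a ∉ Z) {Y : Finset V} (hZY : Z ⊆ Y) :
    prob p (L2 ends U s a o Y) = ∑ ω, weight p ω *
      prob p (L2 ends (U \ Z) s a o ((Y \ Z) ∪ frontier ends U Z ω)) := by
  rw [L2_eq hZU hsZ haZ hZY]
  exact prob_tower p (disjoint_touches_within_sdiff ends U Z) (dependsOn_frontier ends U Z)
    fun T => dependsOn_L2 ((Y \ Z) ∪ T)

/-- `P(R1 Z) = ∑_ω weight ω · P(R1 (frontier ω))` on `G[U ∖ Z]`. -/
lemma prob_R1_eq (p : E → R) (ends : E → Sym2 V) {U Z : Finset V} (hZU : Z ⊆ U) {s a o : V}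
    (hsZ : s ∉ Z) :
    prob p (R1 ends U s a o Z) = ∑ ω, weight p ω *
      prob p (R1 ends (U \ Z) s a o (frontier ends U Z ω)) := by
  rw [R1_eq hZU hsZ]
  exact prob_tower p (disjoint_touches_within_sdiff ends U Z) (dependsOn_frontier ends U Z)
    fun T => dependsOn_R1 T

/-- `P(R2 W) = ∑_ω weight ω · P(R2 (W ∖ Z ∪ frontier ω))` on `G[U ∖ Z]`. -/
lemma prob_R2_eq (p : E → R) (ends : E → Sym2 V) {U Z : Finset V} (hZU : Z ⊆ U) {s a o : V}
    (hsZ : s ∉ Z) (haZ : a ∉ Z) (hoZ : o ∉ Z) {W : Finset V} (hZW : Z ⊆ W) :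
    prob p (R2 ends U s a o W) = ∑ ω, weight p ω *
      prob p (R2 ends (U \ Z) s a o ((W \ Z) ∪ frontier ends U Z ω)) := by
  rw [R2_eq hZU hsZ haZ hoZ hZW]
  exact prob_tower p (disjoint_touches_within_sdiff ends U Z) (dependsOn_frontier ends U Z)
    fun T => dependsOn_R2 ((W \ Z) ∪ T)

end Tower

end TwoMark

end Summit.Ventures.PercRepro2
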